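/-
Copyright (c) 2026. All rights reserved.
Released under Apache 2.0 license as described in the file LICENSE.
Authors: abc-iut cell, prover seat abc-iut-w5-d138 (wave 5, gen 8).
-/
import Summits.ABC.IUTFork.Cor312Ind3IteratesDepthThree
import Summits.ABC.IUTFork.Cor312Ind3IteratesVacuityWildOddPrime
import HarnessLib

/-!
# (Ind3) honest iterates, depth `≥ 3` at `p_v ∣ e`: packet and column level

Proof-only sequel (theorems, no definitions) of `Cor312Ind3IteratesDepthThree.lean` (abc-iut-w5-d138 gen 8:
at a finite place `w` with `p_w` odd, `e(w|p_w) = p_w`, `f(w|p_w) = 1`, `x^{p_w} = p_w(1 − x)` in `F_w`, the honest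
depth-`3` image for the analytic logarithms is EMPTY; at a place over an odd `p` with a `p`-th root of `p` in
`F_w`, every depth is INHABITED), in the packet / column vocabulary of abc-iut-w4-d029 (`Real.honestU`,
`LogShells.tprodImages`, hypothesis `hunit` of `Column.ind3_logShellsDH_of_honestImages`) exactly as
abc-iut-w5-d017's `Cor312Ind3IteratesVacuityRamificationCriterion` §4 and abc-iut-w5-d172's
`Cor312Ind3IteratesVacuityWildOddPrime` §3 ([IUTchIII] Prop. 3.5 (ii) (a), Thm. 3.11 (ii) (Ind3), Rmk. 1.1.1 (i);
S. Mochizuki, *Inter-universal Teichmüller theory III*, kurims (May 2020) [claim: Mochizuki2012, status: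
disputed; cited record-only]):

* `Real.honestU_inr_add_three_eq_empty_of_pow_eq`, `Real.tprodImages_honestU_add_three_eq_empty_of_pow_eq`,
  `Column.unitImage_add_three_eq_empty_of_honestImages_of_pow_eq` — **one place `w ∣ v_ℚ` as above makes
  every honest unit-image clause of depth `m′ ≥ 3` at `v_ℚ` VACUOUS (`∅ ⊆ _`)**, although `p_{v_ℚ} ∣ e(w|p)`;
* `Real.honestU_nonempty_of_pow_prime_mem`, `Column.unitImage_nonempty_of_honestImages_of_pow_prime_mem` —
  **if `F` contains a `p`-th root of the odd prime `p`, every honest unit-image clause over `v_ℚ = p`, of EVERY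
  depth, is NON-vacuous** (upgrades abc-iut-w5-d172's depth-`2` statement p425849 to all depths).

Honest framing: statements ABOUT THE MODEL; nothing here asserts or denies [IUTchIII] Cor. 3.12 or takes a
side; census ≠ verdict; typed ≠ proved.  No definitions, no Prop-valued fact (D-0067 (1)).
-/

noncomputable section

open Set

namespace Summit.ABC.IUTFork.Thm311.Real

open NumberField IsDedekindDomain Literature.IUT.LogVolume Literature.IUT.LogThetaLattice
  Literature.NumberTheory.NumberFields

variable {F : Type} [Field F] [NumberField F]

/-! ## 1. Depth `≥ 3` vacuity from one place of CASE (a) -/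

/-- The honest component at a finite place `w` of the fibre with `p_w` odd, `e(w|p_w) = p_w`, `f(w|p_w) = 1` and
`x^{p_w} = p_w(1 − x)` in `F_w` is EMPTY at every depth `k + 3`. [claim: Mochizuki2012, status: disputed] -/
theorem honestU_inr_add_three_eq_empty_of_pow_eq (X : PilotData F) (m : ℤ) (k : ℕ)
    {vQ : (thetaIndex X).VQ} (w : HeightOneSpectrum (𝓞 F)) (hw : (thetaIndex X).over (.inr w) = vQ)
    (hp2 : residueChar F w ≠ 2) (he : w.asIdeal.ramificationIdx ℤ = residueChar F w)
    (hf : w.asIdeal.inertiaDeg ℤ = 1) (x : w.adicCompletion F)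
    (hx : x ^ residueChar F w = (residueChar F w : w.adicCompletion F) * (1 - x)) :
    honestU X (analyticLogv F) m (k + 3) vQ ⟨.inr w, hw⟩ = ∅ := by
  rw [Nat.add_comm]
  exact nonarchIterImage_analyticLogv_add_three_eq_empty_of_pow_eq w hp2 he hf x hx k

/-- **The pure-tensor unit image of the honest components at depth `k + 3` is EMPTY** at every `v_ℚ` over which
some place `w` of `F` is as above. [claim: Mochizuki2012, status: disputed] -/
theorem tprodImages_honestU_add_three_eq_empty_of_pow_eq (X : PilotData F) (m : ℤ) (k : ℕ)
    (j : (thetaIndex X).Label) {vQ : (thetaIndex X).VQ}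
    (w : HeightOneSpectrum (𝓞 F)) (hw : (thetaIndex X).over (.inr w) = vQ)
    (hp2 : residueChar F w ≠ 2) (he : w.asIdeal.ramificationIdx ℤ = residueChar F w)
    (hf : w.asIdeal.inertiaDeg ℤ = 1) (x : w.adicCompletion F)
    (hx : x ^ residueChar F w = (residueChar F w : w.adicCompletion F) * (1 - x)) :
    (logShellsDH X (analyticLogv F)).tprodImages j vQ (honestU X (analyticLogv F) m (k + 3) vQ) = ∅ :=
  LogShells.tprodImages_eq_empty_of_eq_empty _ j vQ _ ⟨.inr w, hw⟩
    (honestU_inr_add_three_eq_empty_of_pow_eq X m k w hw hp2 he hf x hx)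

/-- **Vacuity of the depth-`≥ 3` (Ind3) unit-image clauses at a `v_ℚ` with `p_{v_ℚ} ∣ e`.** For any column over
`Real.logShellsDH X (analyticLogv F)` whose unit images are the pure-tensor images of the honest components
(hypothesis `hunit` of abc-iut-w4-d029): at every `(m, k + 3, j, v_ℚ)` with a place `w ∣ v_ℚ` of `F` such that
`p_w` is odd, `e(w|p_w) = p_w`, `f(w|p_w) = 1` and `F_w` contains a root of `X^{p_w} + p_w X − p_w`, the unit image
is `∅` — although the depth-`2` clause there is NOT vacuous (`p_w ∣ e(w|p_w)`, abc-iut-w5-d017).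
[claim: Mochizuki2012, status: disputed] -/
theorem _root_.Summit.ABC.IUTFork.Thm311.Column.unitImage_add_three_eq_empty_of_honestImages_of_pow_eq
    (X : PilotData F) (C : Column (logShellsDH X (analyticLogv F)))
    (hunit : ∀ (m : ℤ) (m' : ℕ) (j : (thetaIndex X).Label) (vQ : (thetaIndex X).VQ),
      C.unitImage m m' j vQ =
        (logShellsDH X (analyticLogv F)).tprodImages j vQ (honestU X (analyticLogv F) m m' vQ))
    (m : ℤ) (k : ℕ) (j : (thetaIndex X).Label) {vQ : (thetaIndex X).VQ}
    (w : HeightOneSpectrum (𝓞 F)) (hw : (thetaIndex X).over (.inr w) = vQ)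
    (hp2 : residueChar F w ≠ 2) (he : w.asIdeal.ramificationIdx ℤ = residueChar F w)
    (hf : w.asIdeal.inertiaDeg ℤ = 1) (x : w.adicCompletion F)
    (hx : x ^ residueChar F w = (residueChar F w : w.adicCompletion F) * (1 - x)) :
    C.unitImage m (k + 3) j vQ = ∅ := by
  rw [hunit]
  exact tprodImages_honestU_add_three_eq_empty_of_pow_eq X m k j w hw hp2 he hf x hx

/-! ## 2. All-depth non-vacuity over `v_ℚ = p` when `F` contains a `p`-th root of `p` -/

/-- **If `F` contains a `p`-th root of the odd prime `p`, every honest component of EVERY depth over `v_ℚ = p`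
is NONEMPTY.** [claim: Mochizuki2012, status: disputed] -/
theorem honestU_nonempty_of_pow_prime_mem (X : PilotData F) (p : Nat.Primes) (hp2 : (p : ℕ) ≠ 2) {α : F}
    (hα : α ^ (p : ℕ) = ((p : ℕ) : F)) (m : ℤ) (n : ℕ) (v : (thetaIndex X).Fibre (.inr p : RatPlace)) :
    (honestU X (analyticLogv F) m n (.inr p) v).Nonempty := by
  obtain ⟨x, hx⟩ := v
  obtain ⟨w, rfl, hw⟩ := natCast_mem_of_over_eq X p hx
  obtain ⟨y, hy⟩ := exists_pow_prime_eq_adicCompletion hα w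
  have hres : residueChar F w = p := residueChar_eq_of_prime_natCast_mem w p.2 hw
  have hy' : y ^ residueChar F w = (residueChar F w : w.adicCompletion F) := by rw [hres]; exact hy
  exact nonarchIterImage_analyticLogv_nonempty_of_pow_prime w (hres ▸ hp2) y hy' n

/-- **NON-VACUITY OF EVERY (Ind3) UNIT-IMAGE CLAUSE at `v_ℚ = p`, `p` odd, when `F ∋ p^{1/p}`**: for pilot data
`X` over such a number field and ANY column over `Real.logShellsDH X (analyticLogv F)` with honest unit images,
the unit image at `(m, m′, j, v_ℚ = p)` is NONEMPTY for EVERY `m′` (abc-iut-w5-d172's p425849 had `m′ = 2`).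
[claim: Mochizuki2012, status: disputed] -/
theorem _root_.Summit.ABC.IUTFork.Thm311.Column.unitImage_nonempty_of_honestImages_of_pow_prime_mem
    (X : PilotData F) (p : Nat.Primes) (hp2 : (p : ℕ) ≠ 2) {α : F} (hα : α ^ (p : ℕ) = ((p : ℕ) : F))
    (C : Column (logShellsDH X (analyticLogv F)))
    (hunit : ∀ (m : ℤ) (m' : ℕ) (j : (thetaIndex X).Label) (vQ : (thetaIndex X).VQ),
      C.unitImage m m' j vQ =
        (logShellsDH X (analyticLogv F)).tprodImages j vQ (honestU X (analyticLogv F) m m' vQ))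
    (m : ℤ) (n : ℕ) (j : (thetaIndex X).Label) :
    (C.unitImage m n j (.inr p : RatPlace)).Nonempty := by
  rw [hunit]
  exact LogShells.tprodImages_nonempty_of_forall_nonempty _ j _ _
    (honestU_nonempty_of_pow_prime_mem X p hp2 hα m n)

end Summit.ABC.IUTFork.Thm311.Real

end
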